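import Literature.NumberTheory.GaloisRepresentations.PhiGammaModuleRobba
import Literature.NumberTheory.GaloisRepresentations.FramedRepTwist
import HarnessLib

/-!
# Reindexing `(φ, Γ)`-module data along class bijections of framed Galois representations

Topic `NumberTheory/GaloisRepresentations` (construction wanted by crux `WeightVelocity` of route
`Langlands/SteinbergWeightVelocity`: "KPX datum constructors — Reindexing / class-bijection API").

## Part 1 — conjugacy classes of framed representations and their reindexings

For a topological group `G` and a topological commutative ring `A`, framed continuous
representations `ρ : G →ₜ* GL_n(A)` (`FramedRep`) carry the **change-of-frame relation**
`IsConjugate ρ ρ' :↔ ∃ P ∈ GL_n(A), ρ' = P ρ P⁻¹` (`FramedRep.conj`), the equivalence relation whose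
classes are the isomorphism classes of the underlying representations on `Aⁿ` (Serre, *Linear
representations of finite groups*, §1.2: isomorphic matrix representations are the conjugate ones,
`R'_s = T R_s T⁻¹`; Mazur 1997 §8: framings).  A **reindexing** (`FramedRep.Reindexing G A n`) is a
self-map of `FramedRep G A n` descending to a PERMUTATION of the conjugacy classes
(`isConjugate_map`, `isConjugate_of_map`, `exists_map`); constructors `Reindexing.id`, `comp`,
`ofEquiv`, `dual` (contragredient `ρ ↦ (ρᵀ)⁻¹`: `dual_conj`, `dual_dual`, `dual_one`), `twist χ`
(`ρ ↦ ρ ⊗ χ`, `FramedRep.twist`), `swap r₀ r₁` (transposition of two classes), `twistSwap χ`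
(`ρ ↦ ρ ⊗ χ` corrected on the classes `{1}`, `{χ⁻¹ · 1}` so that `1 ↦ 1`: `twistSwap_one`,
`twistSwap_apply`).  A **family** `FramedRep.ReindexingFamily G A` is one reindexing in every rank,
each fixing the trivial representation (`app_one`; `[1] = {1}` by `isConjugate_one_left_iff`);
constructors `id`, `comp`, `single n Φ h` (act in rank `n` only, e.g. `n = 2`), `restrict S`,
`dual`, `twistSwap χ`.

## Part 2 — reindexed `(φ, Γ)`-module data; invariance of the KPX package

The datum `PhiGammaModuleData p F E` of `Trianguline.lean` (ring `𝓡_E(π_F)`, the rule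
`Drig : FramedGaloisRep F E n → FramedPhiGammaModule _ n`, the rank-one objects `charMod δ`) and its
enrichment `PhiGammaModuleRobba p F E` of `PhiGammaModuleRobba.lean` (topology, `gen`, `homToH1`,
`IsEtale`; the package `IsKPX d`) constrain `Drig` only through ISOMORPHISM CLASSES on both sides:
functoriality in the frame (`Drig_conj`), full faithfulness on classes (`Drig_injective`,
[cite: KedlayaPottharstXiao2014, Thm. 2.2.17]), `Drig 1 ≅ 𝓡ⁿ` (`Drig_one`), the rank-one
classification (`Drig_rank_one`, [cite: KedlayaPottharstXiao2014, Thm. 6.2.14]) and essential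
surjectivity onto étale objects (`HasDrigEtale`).  Consequently, for every family `Φ` of
reindexings fixing `1`, the datum with `Drig` replaced by `Drig ∘ Φ` — **the reindexed datum**
`𝔇.reindex Φ` (`PhiGammaModuleData.reindex`, `PhiGammaModuleRobba.reindex`) — satisfies the same
axioms, and `IsKPX d` is INVARIANT (`PhiGammaModuleRobba.IsKPX.reindex`).  Ring, `charMod`,
cohomology, `homToH1`, `IsEtale` are untouched (the `Drig`-free clauses transfer by `Iff.rfl`),
while "`ρ` is trianguline for `𝔇.reindex Φ`" means "`Φ ρ` is trianguline for `𝔇`"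
(`FramedGaloisRep.isTriangulineWith_reindex_iff`, `isStrictTriangulineRep_reindex_iff`,
`triangulineAt_reindex_iff`, `hasParameterAt_reindex_iff`), whence
`hasParameterAt_reindexed_of_forall_isKPX`: a parameter prescribed for `ρ` in EVERY KPX theory is
also a parameter of `Φ_E(rE)` for some model `rE` of `ρ|Γ_{K_v}`, for every KPX family and every
family of reindexings `Φ`.

This measures how far the typed package is from pinning down Berger's `D_rig^†`: the genuine
`V ↦ D_rig^†(V)` is "fully faithful and exact, and it commutes with base change"
[cite: KedlayaPottharstXiao2014, Thm. 2.2.17], and tensor-functorial (used in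
[cite: KedlayaPottharstXiao2014, Construction 6.2.4]: `𝓡(δ₁) := D_rig^†(δ̂₁)` for unitary `δ₁`, through
the local Artin map), hence compatible with twists and duals; none of "exact / tensor /
twist-compatible / `D_rig^†` of a character is `𝓡(δ ∘ Art_F)`" is a field of the datum, and the
reindexings `twistSwap μ`, `dual` (in all ranks, or in one rank via `single`) turn one KPX datum
into another with different trianguline parameters for a given `ρ` of rank `≥ 2`.  The cure is a
normalisation predicate on the datum (rank-one normalisation through a local Artin datum, twist
compatibility, exactness), to be requested by the routes that need it; NOTHING here asserts it.

## References

* K. S. Kedlaya, J. Pottharst, L. Xiao, *Cohomology of arithmetic families of `(φ, Γ)`-modules*,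
  JAMS 27 (2014), arXiv:1203.5718 — Thm. 2.2.17, Construction 6.2.4, Thm. 6.2.14, Def. 6.3.1.
  [KedlayaPottharstXiao2014]
* D. Hansen, *Universal eigenvarieties, trianguline Galois representations, and `p`-adic Langlands
  functoriality*, Crelle 730 (2017) — §6.1 (parameters), Thm. 6.1.2. [HansenUniversalEigenvarieties2017]
* J.-P. Serre, *Linear representations of finite groups*, GTM 42 (1977), §1.2; B. Mazur, *An
  introduction to the deformation theory of Galois representations* (1997), §8. [folklore]

## Design notes

All of Part 1 is elementary bookkeeping (`[folklore]`); `conj_one'`/`conj_conj'` are local copies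
of `FramedRep.conj_one`/`FramedRep.conj_conj` of `OrdinaryRegular.lean`, which lies outside the
import cone of the `(φ, Γ)`-module files (it would pull local class field theory in).  `swap`
branches on the undecidable relation `IsConjugate` (classical `if`).  `reindex` keeps `ring`,
`charMod` and every enrichment field DEFINITIONALLY.  No fact is asserted (D-0026): every
declaration is a definition or a proved lemma.
-/

noncomputable section

open scoped NumberField
open Field IsDedekindDomain

namespace Literature.NumberTheory.GaloisRepresentations

universe u v w

/-! ## Part 1. Conjugacy classes of framed representations; reindexings -/

namespace FramedRep

variable {G : Type u} {A : Type v} [Group G] [TopologicalSpace G] [CommRing A] [TopologicalSpace A]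
  [IsTopologicalRing A] {n : ℕ}

/-! ### Change of frame: local API -/

/-- Change of frame by `1` is the identity (local copy of `FramedRep.conj_one`). [folklore] -/
private lemma conj_one' (ρ : FramedRep G A n) : ρ.conj 1 = ρ :=
  ContinuousMonoidHom.ext fun g => by simp

/-- Iterated change of frame `Q (P ρ P⁻¹) Q⁻¹ = (QP) ρ (QP)⁻¹` (local copy of
`FramedRep.conj_conj`). [folklore] -/
private lemma conj_conj' (P Q : GL (Fin n) A) (ρ : FramedRep G A n) :
    (ρ.conj P).conj Q = ρ.conj (Q * P) :=
  ContinuousMonoidHom.ext fun g => by simp [mul_assoc]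

/-- The trivial representation is fixed by every change of frame: `P · 1 · P⁻¹ = 1`. [folklore] -/
@[simp] lemma one_conj (P : GL (Fin n) A) : (1 : FramedRep G A n).conj P = 1 :=
  ContinuousMonoidHom.ext fun g => by simp

variable (A n) in
/-- The **scalar representation** `g ↦ χ(g) · 1` of a continuous character `χ` (the twist of the
trivial rank-`n` representation by `χ`). [folklore] -/
abbrev scalarRep (χ : G →ₜ* Aˣ) : FramedRep G A n := (1 : FramedRep G A n).twist χ

/-- Scalar representations are central, hence fixed by every change of frame. [folklore] -/
@[simp] lemma scalarRep_conj (χ : G →ₜ* Aˣ) (P : GL (Fin n) A) :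
    (scalarRep A n χ).conj P = scalarRep A n χ := by
  rw [conj_twist, one_conj]

/-- `χ⁻¹ · (χ · 1) = 1`. [folklore] -/
@[simp] lemma scalarRep_twist_inv (χ : G →ₜ* Aˣ) : (scalarRep A n χ⁻¹).twist χ = 1 := by
  rw [twist_twist, mul_inv_cancel, twist_one]

omit [IsTopologicalRing A] in
/-- `g ↦ (gᵀ)⁻¹` is an involution of `GL_n(A)`. [folklore] -/
@[simp] lemma glTransposeInv_glTransposeInv (g : GL (Fin n) A) :
    glTransposeInv (Fin n) A (glTransposeInv (Fin n) A g) = g := by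
  refine Units.ext ?_
  rw [coe_glTransposeInv_apply, ← map_inv, coe_glTransposeInv_apply, inv_inv, Matrix.transpose_transpose]

/-- Contragredient of a change of frame: `(P ρ P⁻¹)^∨ = P^{-T} ρ^∨ P^{T}`. [folklore] -/
lemma dual_conj (P : GL (Fin n) A) (ρ : FramedRep G A n) :
    (ρ.conj P).dual = ρ.dual.conj (glTransposeInv (Fin n) A P) :=
  ContinuousMonoidHom.ext fun g => by
    change glTransposeInv (Fin n) A (P * ρ g * P⁻¹) = _
    rw [map_mul, map_mul, map_inv]
    rfl

omit [IsTopologicalRing A] in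
/-- The contragredient is an involution: `ρ^∨∨ = ρ`. [folklore] -/
@[simp] lemma dual_dual (ρ : FramedRep G A n) : ρ.dual.dual = ρ :=
  ContinuousMonoidHom.ext fun g => glTransposeInv_glTransposeInv (ρ g)

omit [IsTopologicalRing A] in
/-- The contragredient of the trivial representation is trivial. [folklore] -/
@[simp] lemma dual_one : (1 : FramedRep G A n).dual = 1 :=
  ContinuousMonoidHom.ext fun _ => map_one (glTransposeInv (Fin n) A)

/-! ### The conjugacy relation -/

/-- **`ρ` and `ρ'` are conjugate** (differ by a change of frame): `ρ' = P ρ P⁻¹` for some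
`P ∈ GL_n(A)`, i.e. the representations of `G` on `Aⁿ` underlying `ρ` and `ρ'` are isomorphic
(Serre, *Linear representations of finite groups*, §1.2). [folklore] -/
def IsConjugate (ρ ρ' : FramedRep G A n) : Prop := ∃ P : GL (Fin n) A, ρ' = ρ.conj P

/-- `ρ.conj P` is conjugate to `ρ`. [folklore] -/
lemma isConjugate_conj (ρ : FramedRep G A n) (P : GL (Fin n) A) : IsConjugate ρ (ρ.conj P) :=
  ⟨P, rfl⟩

namespace IsConjugate

/-- Conjugacy is reflexive. [folklore] -/
@[refl] protected lemma refl (ρ : FramedRep G A n) : IsConjugate ρ ρ := ⟨1, (conj_one' ρ).symm⟩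

/-- Conjugacy is reflexive (term form). [folklore] -/
protected lemma rfl {ρ : FramedRep G A n} : IsConjugate ρ ρ := IsConjugate.refl ρ

/-- Conjugacy is symmetric (`P ↦ P⁻¹`). [folklore] -/
@[symm] protected lemma symm {ρ ρ' : FramedRep G A n} (h : IsConjugate ρ ρ') : IsConjugate ρ' ρ := by
  obtain ⟨P, rfl⟩ := h
  exact ⟨P⁻¹, by rw [conj_conj', inv_mul_cancel, conj_one']⟩

/-- Conjugacy is transitive (`P, Q ↦ Q P`). [folklore] -/
@[trans] protected lemma trans {ρ ρ' ρ'' : FramedRep G A n} (h : IsConjugate ρ ρ')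
    (h' : IsConjugate ρ' ρ'') : IsConjugate ρ ρ'' := by
  obtain ⟨P, rfl⟩ := h
  obtain ⟨Q, rfl⟩ := h'
  exact ⟨Q * P, conj_conj' P Q ρ⟩

/-- Conjugate representations have conjugate twists (scalars are central, `conj_twist`).
[folklore] -/
protected lemma twist {ρ ρ' : FramedRep G A n} (h : IsConjugate ρ ρ') (χ : G →ₜ* Aˣ) :
    IsConjugate (ρ.twist χ) (ρ'.twist χ) := by
  obtain ⟨P, rfl⟩ := h
  exact ⟨P, (conj_twist ρ χ P).symm⟩

/-- Conjugate representations have conjugate contragredients (`dual_conj`). [folklore] -/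
protected lemma dual {ρ ρ' : FramedRep G A n} (h : IsConjugate ρ ρ') : IsConjugate ρ.dual ρ'.dual := by
  obtain ⟨P, rfl⟩ := h
  exact ⟨_, dual_conj P ρ⟩

end IsConjugate

/-- Conjugacy is an equivalence relation. [folklore] -/
lemma isConjugate_equivalence : Equivalence (IsConjugate (G := G) (A := A) (n := n)) :=
  ⟨IsConjugate.refl, IsConjugate.symm, IsConjugate.trans⟩

variable (G A n) in
/-- The change-of-frame setoid on `FramedRep G A n`; its quotient is the set of isomorphism
classes of continuous representations of `G` on `Aⁿ` admitting a frame. [folklore] -/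
def conjSetoid : Setoid (FramedRep G A n) := ⟨IsConjugate, isConjugate_equivalence⟩

/-- Conjugacy is unchanged by reframing the left argument. [folklore] -/
@[simp] lemma isConjugate_conj_left_iff {ρ ρ' : FramedRep G A n} {P : GL (Fin n) A} :
    IsConjugate (ρ.conj P) ρ' ↔ IsConjugate ρ ρ' :=
  ⟨fun h => (isConjugate_conj ρ P).trans h, fun h => (isConjugate_conj ρ P).symm.trans h⟩

/-- Conjugacy is unchanged by reframing the right argument. [folklore] -/
@[simp] lemma isConjugate_conj_right_iff {ρ ρ' : FramedRep G A n} {P : GL (Fin n) A} :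
    IsConjugate ρ (ρ'.conj P) ↔ IsConjugate ρ ρ' :=
  ⟨fun h => h.trans (isConjugate_conj ρ' P).symm, fun h => h.trans (isConjugate_conj ρ' P)⟩

/-- Twisting is injective on classes: `ρ ⊗ χ ~ ρ' ⊗ χ ↔ ρ ~ ρ'`. [folklore] -/
@[simp] lemma isConjugate_twist_iff {ρ ρ' : FramedRep G A n} (χ : G →ₜ* Aˣ) :
    IsConjugate (ρ.twist χ) (ρ'.twist χ) ↔ IsConjugate ρ ρ' :=
  ⟨fun h => by simpa only [twist_twist_inv] using h.twist χ⁻¹, fun h => h.twist χ⟩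

/-- The contragredient is injective on classes. [folklore] -/
@[simp] lemma isConjugate_dual_iff {ρ ρ' : FramedRep G A n} :
    IsConjugate ρ.dual ρ'.dual ↔ IsConjugate ρ ρ' :=
  ⟨fun h => by simpa only [dual_dual] using h.dual, fun h => h.dual⟩

/-- The class of the trivial representation is a singleton: `1 ~ ρ ↔ ρ = 1`. [folklore] -/
@[simp] lemma isConjugate_one_left_iff {ρ : FramedRep G A n} : IsConjugate 1 ρ ↔ ρ = 1 :=
  ⟨fun ⟨P, hP⟩ => hP.trans (one_conj P), fun h => h ▸ IsConjugate.rfl⟩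

/-- The class of the trivial representation is a singleton: `ρ ~ 1 ↔ ρ = 1`. [folklore] -/
@[simp] lemma isConjugate_one_right_iff {ρ : FramedRep G A n} : IsConjugate ρ 1 ↔ ρ = 1 :=
  ⟨fun h => isConjugate_one_left_iff.1 h.symm, fun h => h ▸ IsConjugate.rfl⟩

/-- The class of a scalar representation is a singleton. [folklore] -/
@[simp] lemma isConjugate_scalarRep_iff {χ : G →ₜ* Aˣ} {ρ : FramedRep G A n} :
    IsConjugate (scalarRep A n χ) ρ ↔ ρ = scalarRep A n χ :=
  ⟨fun ⟨P, hP⟩ => hP.trans (scalarRep_conj χ P), fun h => h ▸ IsConjugate.rfl⟩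

/-! ### Reindexings of one rank -/

variable (G A n) in
/-- A **reindexing of rank-`n` framed representations**: a self-map `Φ` of `FramedRep G A n`
sending conjugate representations to conjugate ones (`isConjugate_map`) and inducing a BIJECTION
of conjugacy classes (`isConjugate_of_map`: injective on classes; `exists_map`: every class is
hit) — an autoequivalence, chosen on representatives, of the groupoid of framed representations.
[folklore] -/
structure Reindexing where
  /-- The map on framed representations. -/
  toFun : FramedRep G A n → FramedRep G A n
  /-- Conjugate representations go to conjugate representations. -/
  isConjugate_map : ∀ ⦃ρ ρ' : FramedRep G A n⦄, IsConjugate ρ ρ' → IsConjugate (toFun ρ) (toFun ρ')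
  /-- Injective on classes. -/
  isConjugate_of_map : ∀ ⦃ρ ρ' : FramedRep G A n⦄, IsConjugate (toFun ρ) (toFun ρ') → IsConjugate ρ ρ'
  /-- Surjective on classes. -/
  exists_map : ∀ ρ' : FramedRep G A n, ∃ ρ, IsConjugate (toFun ρ) ρ'

namespace Reindexing

/-- A reindexing is used as a function on framed representations. [folklore] -/
instance : CoeFun (Reindexing G A n) fun _ => FramedRep G A n → FramedRep G A n := ⟨toFun⟩

/-- `Φ ρ ~ Φ ρ' ↔ ρ ~ ρ'`. [folklore] -/
lemma isConjugate_map_iff (Φ : Reindexing G A n) {ρ ρ' : FramedRep G A n} :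
    IsConjugate (Φ ρ) (Φ ρ') ↔ IsConjugate ρ ρ' :=
  ⟨fun h => Φ.isConjugate_of_map h, fun h => Φ.isConjugate_map h⟩

variable (G A n) in
/-- The identity reindexing. [folklore] -/
protected def id : Reindexing G A n where
  toFun := id
  isConjugate_map _ _ h := h
  isConjugate_of_map _ _ h := h
  exists_map ρ := ⟨ρ, IsConjugate.rfl⟩

/-- The identity reindexing is the identity map. [folklore] -/
@[simp] lemma id_apply (ρ : FramedRep G A n) : Reindexing.id G A n ρ = ρ := rfl

/-- Composition of reindexings (`Ψ` after `Φ`). [folklore] -/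
def comp (Ψ Φ : Reindexing G A n) : Reindexing G A n where
  toFun := Ψ ∘ Φ
  isConjugate_map _ _ h := Ψ.isConjugate_map (Φ.isConjugate_map h)
  isConjugate_of_map _ _ h := Φ.isConjugate_of_map (Ψ.isConjugate_of_map h)
  exists_map ρ'' := by
    obtain ⟨ρ', h'⟩ := Ψ.exists_map ρ''
    obtain ⟨ρ, h⟩ := Φ.exists_map ρ'
    exact ⟨ρ, (Ψ.isConjugate_map h).trans h'⟩

/-- Unfolding lemma for `comp`. [folklore] -/
@[simp] lemma comp_apply (Ψ Φ : Reindexing G A n) (ρ : FramedRep G A n) : Ψ.comp Φ ρ = Ψ (Φ ρ) := rfl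

/-- A bijection of `FramedRep G A n` which, together with its inverse, respects conjugacy is a
reindexing. [folklore] -/
def ofEquiv (e : FramedRep G A n ≃ FramedRep G A n)
    (he : ∀ ⦃ρ ρ' : FramedRep G A n⦄, IsConjugate ρ ρ' → IsConjugate (e ρ) (e ρ'))
    (he' : ∀ ⦃ρ ρ' : FramedRep G A n⦄, IsConjugate ρ ρ' → IsConjugate (e.symm ρ) (e.symm ρ')) :
    Reindexing G A n where
  toFun := e
  isConjugate_map := he
  isConjugate_of_map ρ ρ' h := by simpa only [Equiv.symm_apply_apply] using he' h
  exists_map ρ' := ⟨e.symm ρ', by rw [Equiv.apply_symm_apply]⟩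

/-- Unfolding lemma for `ofEquiv`. [folklore] -/
@[simp] lemma ofEquiv_apply (e : FramedRep G A n ≃ FramedRep G A n)
    (he : ∀ ⦃ρ ρ' : FramedRep G A n⦄, IsConjugate ρ ρ' → IsConjugate (e ρ) (e ρ'))
    (he' : ∀ ⦃ρ ρ' : FramedRep G A n⦄, IsConjugate ρ ρ' → IsConjugate (e.symm ρ) (e.symm ρ'))
    (ρ : FramedRep G A n) : ofEquiv e he he' ρ = e ρ := rfl

variable (G A n) in
/-- **The contragredient reindexing** `ρ ↦ ρ^∨ = (ρᵀ)⁻¹` (an involution, `dual_dual`; equivariant,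
`dual_conj`; fixes `1`, `dual_one`). [folklore] -/
def dual : Reindexing G A n :=
  ofEquiv ⟨FramedRep.dual, FramedRep.dual, dual_dual, dual_dual⟩ (fun _ _ h => h.dual) fun _ _ h => h.dual

/-- Unfolding lemma for `dual`. [folklore] -/
@[simp] lemma dual_apply (ρ : FramedRep G A n) : dual G A n ρ = ρ.dual := rfl

/-- **The twist reindexing** `ρ ↦ ρ ⊗ χ` by a continuous character (inverse `ρ ↦ ρ ⊗ χ⁻¹`; it does
NOT fix `1`: `1 ↦ χ · 1`, cf. `twistSwap`). [folklore] -/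
def twist (χ : G →ₜ* Aˣ) : Reindexing G A n :=
  ofEquiv ⟨fun ρ => ρ.twist χ, fun ρ => ρ.twist χ⁻¹, fun ρ => twist_twist_inv ρ χ,
      fun ρ => show (ρ.twist χ⁻¹).twist χ = ρ by rw [twist_twist, mul_inv_cancel, twist_one]⟩
    (fun _ _ h => h.twist χ) fun _ _ h => h.twist χ⁻¹

/-- Unfolding lemma for `twist`. [folklore] -/
@[simp] lemma twist_apply (χ : G →ₜ* Aˣ) (ρ : FramedRep G A n) : twist χ ρ = ρ.twist χ := rfl

open scoped Classical in
/-- **The transposition of two classes**: `Φ` maps the class of `r₀` onto (the representative) `r₁`,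
the class of `r₁` onto `r₀`, and fixes every other representation; if the two classes coincide it
induces the identity on classes. [folklore] -/
def swap (r₀ r₁ : FramedRep G A n) : Reindexing G A n where
  toFun ρ := if IsConjugate r₀ ρ then r₁ else if IsConjugate r₁ ρ then r₀ else ρ
  isConjugate_map ρ ρ' h := by
    have e₀ : IsConjugate r₀ ρ ↔ IsConjugate r₀ ρ' := ⟨fun h₀ => h₀.trans h, fun h₀ => h₀.trans h.symm⟩
    have e₁ : IsConjugate r₁ ρ ↔ IsConjugate r₁ ρ' := ⟨fun h₁ => h₁.trans h, fun h₁ => h₁.trans h.symm⟩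
    by_cases h₀ : IsConjugate r₀ ρ
    · rw [if_pos h₀, if_pos (e₀.1 h₀)]
    · by_cases h₁ : IsConjugate r₁ ρ
      · rw [if_neg h₀, if_pos h₁, if_neg (mt e₀.2 h₀), if_pos (e₁.1 h₁)]
      · rwa [if_neg h₀, if_neg h₁, if_neg (mt e₀.2 h₀), if_neg (mt e₁.2 h₁)]
  isConjugate_of_map ρ ρ' h := by
    by_cases h₀ : IsConjugate r₀ ρ <;> by_cases h₀' : IsConjugate r₀ ρ' <;>
      by_cases h₁ : IsConjugate r₁ ρ <;> by_cases h₁' : IsConjugate r₁ ρ' <;>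
      simp only [h₀, h₀', h₁, h₁', if_true, if_false] at h
    all_goals first
      | exact h₀.symm.trans h₀'
      | exact h₁.symm.trans h₁'
      | exact h
      | exact absurd (h.symm.trans h₁') h₀'
      | exact absurd h h₁'
      | exact absurd (h.trans h₁) h₀
      | exact absurd h h₀'
      | exact absurd h.symm h₁
      | exact absurd h.symm h₀
  exists_map ρ' := by
    by_cases h₀ : IsConjugate r₀ ρ'
    · refine ⟨r₁, ?_⟩
      by_cases h₀₁ : IsConjugate r₀ r₁
      · rw [if_pos h₀₁]; exact h₀₁.symm.trans h₀
      · rw [if_neg h₀₁, if_pos IsConjugate.rfl]; exact h₀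
    · by_cases h₁ : IsConjugate r₁ ρ'
      · exact ⟨r₀, by rw [if_pos IsConjugate.rfl]; exact h₁⟩
      · exact ⟨ρ', by rw [if_neg h₀, if_neg h₁]⟩

/-- `swap` on the class of `r₀`. [folklore] -/
lemma swap_apply_of_left {r₀ r₁ ρ : FramedRep G A n} (h : IsConjugate r₀ ρ) : swap r₀ r₁ ρ = r₁ := by
  classical exact if_pos h

/-- `swap` on the class of `r₁` (off the class of `r₀`). [folklore] -/
lemma swap_apply_of_right {r₀ r₁ ρ : FramedRep G A n} (h₀ : ¬ IsConjugate r₀ ρ)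
    (h₁ : IsConjugate r₁ ρ) : swap r₀ r₁ ρ = r₀ := by
  classical exact (if_neg h₀).trans (if_pos h₁)

/-- `swap` off the two classes is the identity. [folklore] -/
lemma swap_apply_of_not {r₀ r₁ ρ : FramedRep G A n} (h₀ : ¬ IsConjugate r₀ ρ)
    (h₁ : ¬ IsConjugate r₁ ρ) : swap r₀ r₁ ρ = ρ := by
  classical exact (if_neg h₀).trans (if_neg h₁)

/-- `swap r₀ r₁ r₀ = r₁`. [folklore] -/
@[simp] lemma swap_apply_self_left (r₀ r₁ : FramedRep G A n) : swap r₀ r₁ r₀ = r₁ :=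
  swap_apply_of_left IsConjugate.rfl

/-- `swap r₀ r₁ r₁ = r₀` when the two classes differ. [folklore] -/
lemma swap_apply_self_right {r₀ r₁ : FramedRep G A n} (h : ¬ IsConjugate r₀ r₁) : swap r₀ r₁ r₁ = r₀ :=
  swap_apply_of_right h IsConjugate.rfl

/-- A transposition of two classes away from `[1] = {1}` fixes the trivial representation.
[folklore] -/
lemma swap_one {r₀ r₁ : FramedRep G A n} (h₀ : r₀ ≠ 1) (h₁ : r₁ ≠ 1) : swap r₀ r₁ 1 = 1 :=
  swap_apply_of_not (fun h => h₀ (isConjugate_one_right_iff.1 h))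
    fun h => h₁ (isConjugate_one_right_iff.1 h)

/-- **The twist reindexing corrected to fix `1`**: first transpose the classes `{1}` and
`{χ⁻¹ · 1}`, then twist by `χ`.  So `1 ↦ 1`, `χ⁻¹ · 1 ↦ χ · 1`, and `ρ ↦ ρ ⊗ χ` for every other
`ρ` (`twistSwap_one`, `twistSwap_apply`). [folklore] -/
def twistSwap (χ : G →ₜ* Aˣ) : Reindexing G A n := (twist χ).comp (swap 1 (scalarRep A n χ⁻¹))

/-- `twistSwap χ` fixes the trivial representation. [folklore] -/
@[simp] lemma twistSwap_one (χ : G →ₜ* Aˣ) : twistSwap (n := n) χ 1 = 1 := by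
  rw [twistSwap, comp_apply, swap_apply_of_left IsConjugate.rfl, twist_apply, scalarRep_twist_inv]

/-- Off `1` and `χ⁻¹ · 1`, `twistSwap χ` is the twist `ρ ↦ ρ ⊗ χ`. [folklore] -/
lemma twistSwap_apply (χ : G →ₜ* Aˣ) {ρ : FramedRep G A n} (h₁ : ρ ≠ 1) (hχ : ρ ≠ scalarRep A n χ⁻¹) :
    twistSwap χ ρ = ρ.twist χ := by
  rw [twistSwap, comp_apply, twist_apply, swap_apply_of_not (fun h => h₁ (isConjugate_one_left_iff.1 h))
    fun h => hχ (isConjugate_scalarRep_iff.1 h)]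

/-- `twistSwap χ` sends `χ⁻¹ · 1` to `χ · 1`. [folklore] -/
lemma twistSwap_scalarRep_inv (χ : G →ₜ* Aˣ) : twistSwap (n := n) χ (scalarRep A n χ⁻¹) = scalarRep A n χ := by
  rw [twistSwap, comp_apply, twist_apply]
  by_cases h : IsConjugate (1 : FramedRep G A n) (scalarRep A n χ⁻¹)
  · have hs : scalarRep A n χ⁻¹ = 1 := isConjugate_one_left_iff.1 h
    rw [swap_apply_of_left h, scalarRep_twist_inv]
    calc (1 : FramedRep G A n) = (scalarRep A n χ⁻¹).twist χ := (scalarRep_twist_inv χ).symm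
      _ = scalarRep A n χ := by rw [hs]
  · rw [swap_apply_of_right h IsConjugate.rfl]

end Reindexing

/-! ### Families of reindexings, one in every rank, fixing the trivial representation -/

variable (G A) in
/-- A **family of reindexings**, one in every rank `n`, each fixing the trivial representation
(`[1] = {1}`, so "fixes the class of `1`" is `Φ 1 = 1`).  This is exactly what precomposition of a
class-level interface such as `PhiGammaModuleData.Drig` (axiom `Drig_one`) can absorb. [folklore] -/
structure ReindexingFamily where
  /-- The reindexing in rank `n`. -/
  app : ∀ n : ℕ, Reindexing G A n
  /-- Each `app n` fixes the trivial representation. -/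
  app_one : ∀ n : ℕ, app n 1 = 1

namespace ReindexingFamily

attribute [simp] app_one

variable (G A) in
/-- The identity family. [folklore] -/
protected def id : ReindexingFamily G A := ⟨fun n => Reindexing.id G A n, fun _ => rfl⟩

/-- The identity family acts as the identity. [folklore] -/
@[simp] lemma id_app (m : ℕ) : (ReindexingFamily.id G A).app m = Reindexing.id G A m := rfl

/-- Composition of families, rank by rank. [folklore] -/
def comp (Ψ Φ : ReindexingFamily G A) : ReindexingFamily G A :=
  ⟨fun n => (Ψ.app n).comp (Φ.app n), fun n => by rw [Reindexing.comp_apply, Φ.app_one, Ψ.app_one]⟩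

/-- Unfolding lemma for `comp`. [folklore] -/
@[simp] lemma comp_app (Ψ Φ : ReindexingFamily G A) (m : ℕ) : (Ψ.comp Φ).app m = (Ψ.app m).comp (Φ.app m) := rfl

/-- **Act in one rank only**: the family which is `Φ` in rank `n` and the identity elsewhere
(e.g. `single 2 (Reindexing.twistSwap χ) (twistSwap_one χ)`). [folklore] -/
def single (n : ℕ) (Φ : Reindexing G A n) (h : Φ 1 = 1) : ReindexingFamily G A where
  app := Function.update (fun m => Reindexing.id G A m) n Φ
  app_one m := by
    by_cases hm : m = n
    · subst hm; rwa [Function.update_self]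
    · rw [Function.update_of_ne hm]; rfl

/-- `single n Φ h` is `Φ` in rank `n`. [folklore] -/
@[simp] lemma single_app_self (n : ℕ) (Φ : Reindexing G A n) (h : Φ 1 = 1) : (single n Φ h).app n = Φ :=
  Function.update_self n Φ _

/-- `single n Φ h` is the identity in ranks `m ≠ n`. [folklore] -/
lemma single_app_of_ne {m n : ℕ} (hm : m ≠ n) (Φ : Reindexing G A n) (h : Φ 1 = 1) :
    (single n Φ h).app m = Reindexing.id G A m :=
  Function.update_of_ne hm Φ _

/-- **Restrict a family to a set of ranks** (identity off `S`), e.g. `S = {m | 2 ≤ m}`. [folklore] -/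
def restrict (Φ : ReindexingFamily G A) (S : Set ℕ) [DecidablePred (· ∈ S)] : ReindexingFamily G A :=
  ⟨fun m => if m ∈ S then Φ.app m else Reindexing.id G A m, fun m => by split_ifs <;> simp⟩

/-- `restrict` on a rank in `S`. [folklore] -/
lemma restrict_app_of_mem (Φ : ReindexingFamily G A) {S : Set ℕ} [DecidablePred (· ∈ S)] {m : ℕ}
    (hm : m ∈ S) : (Φ.restrict S).app m = Φ.app m := if_pos hm

/-- `restrict` on a rank outside `S`. [folklore] -/
lemma restrict_app_of_not_mem (Φ : ReindexingFamily G A) {S : Set ℕ} [DecidablePred (· ∈ S)] {m : ℕ}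
    (hm : m ∉ S) : (Φ.restrict S).app m = Reindexing.id G A m := if_neg hm

variable (G A) in
/-- The contragredient in every rank. [folklore] -/
def dual : ReindexingFamily G A := ⟨fun n => Reindexing.dual G A n, fun _ => dual_one⟩

/-- Unfolding lemma for `dual`. [folklore] -/
@[simp] lemma dual_app (m : ℕ) : (dual G A).app m = Reindexing.dual G A m := rfl

/-- The corrected twist `Reindexing.twistSwap χ` in every rank. [folklore] -/
def twistSwap (χ : G →ₜ* Aˣ) : ReindexingFamily G A :=
  ⟨fun _ => Reindexing.twistSwap χ, fun _ => Reindexing.twistSwap_one χ⟩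

/-- Unfolding lemma for `twistSwap`. [folklore] -/
@[simp] lemma twistSwap_app (χ : G →ₜ* Aˣ) (m : ℕ) : (twistSwap χ).app m = Reindexing.twistSwap χ := rfl

end ReindexingFamily

end FramedRep

/-! ## Part 2. Reindexed `(φ, Γ)`-module data -/

/-! ### Reindexing the datum of `Trianguline.lean` -/

namespace PhiGammaModuleData

variable {p : ℕ} [Fact p.Prime] {F : Type u} [Field F] [TopologicalSpace F]
  {E : Type v} [Field E] [TopologicalSpace E] [IsTopologicalRing E]
  (𝔇 : PhiGammaModuleData.{u, v, w} p F E) (Φ : FramedRep.ReindexingFamily (absoluteGaloisGroup F) E)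

/-- **The reindexed datum** `𝔇.reindex Φ`: same `(φ, Γ)`-ring, same rank-one objects `𝓡(δ)`, and
`Drig ρ := 𝔇.Drig (Φ ρ)` for a family `Φ` of reindexings of framed representations of `Γ_F` fixing
`1`.  The axioms transfer: `Drig_conj` by `isConjugate_map`, `Drig_injective` (KPX Thm. 2.2.17 as an
axiom on classes) by `isConjugate_of_map`, `Drig_one` by `Φ 1 = 1`, `Drig_rank_one` because `Φ`
preserves the rank. [folklore] -/
def reindex : PhiGammaModuleData.{u, v, w} p F E where
  ring := 𝔇.ring
  smul_eq_self := 𝔇.smul_eq_self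
  Drig ρ := 𝔇.Drig (Φ.app _ ρ)
  Drig_matGamma_eq_one ρ σ hσ := 𝔇.Drig_matGamma_eq_one (Φ.app _ ρ) σ hσ
  Drig_conj g ρ := by
    obtain ⟨g', hg'⟩ := (Φ.app _).isConjugate_map (FramedRep.isConjugate_conj ρ g)
    rw [hg']
    exact 𝔇.Drig_conj g' (Φ.app _ ρ)
  Drig_injective ρ ρ' h := (Φ.app _).isConjugate_of_map (𝔇.Drig_injective _ _ h)
  Drig_one n := by
    show (𝔇.Drig (Φ.app n 1)).IsIso _
    rw [Φ.app_one]
    exact 𝔇.Drig_one n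
  charMod := 𝔇.charMod
  charMod_matGamma_eq_one := 𝔇.charMod_matGamma_eq_one
  charMod_one := 𝔇.charMod_one
  charMod_injective := 𝔇.charMod_injective
  Drig_rank_one η := 𝔇.Drig_rank_one (Φ.app 1 η)

/-- The ring is unchanged. [folklore] -/
@[simp] lemma reindex_ring : (𝔇.reindex Φ).ring = 𝔇.ring := rfl

/-- `Drig` of the reindexed datum is `Drig ∘ Φ`. [folklore] -/
@[simp] lemma reindex_Drig {n : ℕ} (ρ : FramedGaloisRep F E n) :
    (𝔇.reindex Φ).Drig ρ = 𝔇.Drig (Φ.app n ρ) := rfl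

/-- The rank-one objects `𝓡(δ)` are unchanged. [folklore] -/
@[simp] lemma reindex_charMod : (𝔇.reindex Φ).charMod = 𝔇.charMod := rfl

/-- The scalars `a_δ` are unchanged. [folklore] -/
@[simp] lemma reindex_charPhi (δ : Fˣ →ₜ* Eˣ) : (𝔇.reindex Φ).charPhi δ = 𝔇.charPhi δ := rfl

/-- The scalars `c_δ(σ)` are unchanged. [folklore] -/
@[simp] lemma reindex_charGamma (δ : Fˣ →ₜ* Eˣ) (σ : absoluteGaloisGroup F) :
    (𝔇.reindex Φ).charGamma δ σ = 𝔇.charGamma δ σ := rfl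

/-- Reindexing along the identity family does nothing. [folklore] -/
@[simp] lemma reindex_id : 𝔇.reindex (FramedRep.ReindexingFamily.id _ E) = 𝔇 := rfl

/-- Iterated reindexing is reindexing along the composite family. [folklore] -/
lemma reindex_reindex (Ψ : FramedRep.ReindexingFamily (absoluteGaloisGroup F) E) :
    (𝔇.reindex Φ).reindex Ψ = 𝔇.reindex (Φ.comp Ψ) := rfl

/-- Triangulinity OF A FRAMED MODULE is the same predicate for `𝔇` and `𝔇.reindex Φ` (it only uses
the ring and `charMod`). [folklore] -/
lemma reindex_isTriangulineWith_iff {n : ℕ} (D : FramedPhiGammaModule 𝔇.ring n)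
    (δ : Fin n → (Fˣ →ₜ* Eˣ)) : (𝔇.reindex Φ).IsTriangulineWith D δ ↔ 𝔇.IsTriangulineWith D δ :=
  Iff.rfl

end PhiGammaModuleData

namespace FramedGaloisRep

variable {p : ℕ} [Fact p.Prime] {F : Type u} [Field F] [TopologicalSpace F]
  {E : Type v} [Field E] [TopologicalSpace E] [IsTopologicalRing E] {n : ℕ}
  (𝔇 : PhiGammaModuleData.{u, v, w} p F E) (Φ : FramedRep.ReindexingFamily (absoluteGaloisGroup F) E)

/-- **`ρ` is trianguline with parameter `δ` for the reindexed datum iff `Φ ρ` is for `𝔇`.**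
[folklore] -/
theorem isTriangulineWith_reindex_iff (ρ : FramedGaloisRep F E n) (δ : Fin n → (Fˣ →ₜ* Eˣ)) :
    ρ.IsTriangulineWith (𝔇.reindex Φ) δ ↔ IsTriangulineWith 𝔇 (Φ.app n ρ) δ :=
  Iff.rfl

/-- `ρ` is trianguline for the reindexed datum iff `Φ ρ` is for `𝔇`. [folklore] -/
theorem isTrianguline_reindex_iff (ρ : FramedGaloisRep F E n) :
    ρ.IsTrianguline (𝔇.reindex Φ) ↔ IsTrianguline 𝔇 (Φ.app n ρ) :=
  Iff.rfl

/-- `Par_{𝔇.reindex Φ}(ρ) = Par_𝔇(Φ ρ)`. [folklore] -/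
theorem parameters_reindex (ρ : FramedGaloisRep F E n) :
    ρ.parameters (𝔇.reindex Φ) = parameters 𝔇 (Φ.app n ρ) :=
  rfl

end FramedGaloisRep

/-! ### Reindexing the enriched datum of `PhiGammaModuleRobba.lean`; invariance of `IsKPX` -/

namespace PhiGammaModuleRobba

variable {p : ℕ} [Fact p.Prime] {F : Type u} [Field F] [TopologicalSpace F]
  {E : Type v} [Field E] [TopologicalSpace E] [IsTopologicalRing E]
  (𝓣 : PhiGammaModuleRobba.{u, v, w} p F E) (Φ : FramedRep.ReindexingFamily (absoluteGaloisGroup F) E)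

/-- **The reindexed enriched datum**: `𝓣.toPhiGammaModuleData.reindex Φ` with the SAME topology,
generator `gen`, class-field-theory map `homToH1` and predicate `IsEtale`. [folklore] -/
def reindex : PhiGammaModuleRobba.{u, v, w} p F E where
  toPhiGammaModuleData := 𝓣.toPhiGammaModuleData.reindex Φ
  topR := 𝓣.topR
  topRingR := 𝓣.topRingR
  continuous_frob := 𝓣.continuous_frob
  continuous_act := 𝓣.continuous_act
  continuous_orbit := 𝓣.continuous_orbit
  gen := 𝓣.gen
  dense_gen := 𝓣.dense_gen
  homToH1 := 𝓣.homToH1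
  IsEtale := 𝓣.IsEtale

/-- The underlying datum of the reindexed enriched datum. [folklore] -/
@[simp] lemma reindex_toPhiGammaModuleData :
    (𝓣.reindex Φ).toPhiGammaModuleData = 𝓣.toPhiGammaModuleData.reindex Φ := rfl

/-- `Drig` of the reindexed enriched datum is `Drig ∘ Φ`. [folklore] -/
@[simp] lemma reindex_Drig {n : ℕ} (ρ : FramedGaloisRep F E n) :
    (𝓣.reindex Φ).Drig ρ = 𝓣.Drig (Φ.app n ρ) := rfl

/-- The generator `gen` is unchanged. [folklore] -/
@[simp] lemma reindex_gen : (𝓣.reindex Φ).gen = 𝓣.gen := rfl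

/-- The based rank-one data `ofChar δ` are unchanged. [folklore] -/
@[simp] lemma reindex_ofChar (δ : Fˣ →ₜ* Eˣ) : (𝓣.reindex Φ).ofChar δ = 𝓣.ofChar δ := rfl

/-- Reindexing along the identity family does nothing. [folklore] -/
@[simp] lemma reindex_id : 𝓣.reindex (FramedRep.ReindexingFamily.id _ E) = 𝓣 := rfl

/-- **Strict triangulinity for the reindexed datum is strict triangulinity of `Φ ρ`.** [folklore] -/
theorem isStrictTriangulineRep_reindex_iff {n : ℕ} (ρ : FramedGaloisRep F E n)
    (δ : Fin n → (Fˣ →ₜ* Eˣ)) :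
    (𝓣.reindex Φ).IsStrictTriangulineRep ρ δ ↔ 𝓣.IsStrictTriangulineRep (Φ.app n ρ) δ :=
  Iff.rfl

/-- Liu finiteness does not mention `Drig`: invariant. [folklore] -/
theorem hasLiuFiniteness_reindex_iff (d : ℕ) :
    (𝓣.reindex Φ).HasLiuFiniteness d ↔ 𝓣.HasLiuFiniteness d :=
  Iff.rfl

/-- Rank-one cohomology does not mention `Drig`: invariant. [folklore] -/
theorem hasRankOneCohomology_reindex_iff (d : ℕ) :
    (𝓣.reindex Φ).HasRankOneCohomology d ↔ 𝓣.HasRankOneCohomology d :=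
  Iff.rfl

/-- The rank-one classification does not mention `Drig`: invariant. [folklore] -/
theorem hasRankOneClassification_reindex_iff :
    (𝓣.reindex Φ).HasRankOneClassification ↔ 𝓣.HasRankOneClassification :=
  Iff.rfl

/-- The class-field-theory identification does not mention `Drig`: invariant. [folklore] -/
theorem hasCFTIdentification_reindex_iff :
    (𝓣.reindex Φ).HasCFTIdentification ↔ 𝓣.HasCFTIdentification :=
  Iff.rfl

variable {𝓣} in
/-- **`HasDrigEtale` transfers to the reindexed datum**: continuity/étaleness of `Drig (Φ ρ)` is an
instance of that of all `Drig ρ'`; essential surjectivity onto étale objects uses that `Φ` hits every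
class (`exists_map`) and `Drig_conj`. [folklore] -/
theorem HasDrigEtale.reindex (h : 𝓣.HasDrigEtale) : (𝓣.reindex Φ).HasDrigEtale := by
  obtain ⟨h1, h2, h3⟩ := h
  refine ⟨fun n ρ => h1 n (Φ.app n ρ), h2, fun n D hcyc hcont het => ?_⟩
  obtain ⟨ρ, hρ⟩ := h3 n D hcyc hcont het
  obtain ⟨ρ', g, hg⟩ := (Φ.app n).exists_map ρ
  refine ⟨ρ', ?_⟩
  show (𝓣.Drig (Φ.app n ρ')).IsIso D
  have hiso := 𝓣.Drig_conj g (Φ.app n ρ')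
  rw [← hg] at hiso
  exact hiso.trans hρ

variable {𝓣} in
/-- **The KPX package is invariant under reindexing**: if `𝓣` satisfies `IsKPX d` then so does
`𝓣.reindex Φ` for every family `Φ` of class bijections fixing `1` — the typed package constrains
`Drig` only up to an autoequivalence of the groupoid of framed representations. [folklore] -/
theorem IsKPX.reindex {d : ℕ} (h : 𝓣.IsKPX d) : (𝓣.reindex Φ).IsKPX d :=
  ⟨h.1, h.2.1, h.2.2.1, h.2.2.2.1, h.2.2.2.2.reindex Φ⟩

end PhiGammaModuleRobba

/-! ### Global level: `TriangulineAt` / `HasParameterAt` for reindexed families -/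

namespace FramedGaloisRep

variable {K : Type} [Field K] [NumberField K] {p : ℕ} [Fact p.Prime] {n : ℕ}

/-- `ρ` is trianguline at `v` for the reindexed family iff some model `rE` of `ρ|Γ_{K_v}` has `Φ_E rE`
trianguline for the original family. [folklore] -/
theorem triangulineAt_reindex_iff (v : HeightOneSpectrum (𝓞 K))
    (𝔇 : ∀ E : IntermediateField ℚ_[p] (PadicAlgCl p), FiniteDimensional ℚ_[p] E →
      PhiGammaModuleData.{0, 0, 0} p (v.adicCompletion K) E)
    (Φ : ∀ E : IntermediateField ℚ_[p] (PadicAlgCl p), FiniteDimensional ℚ_[p] E →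
      FramedRep.ReindexingFamily (absoluteGaloisGroup (v.adicCompletion K)) E)
    (ρ : FramedGaloisRep K (PadicAlgCl p) n) :
    ρ.TriangulineAt v (fun E hE => (𝔇 E hE).reindex (Φ E hE)) ↔
      ∃ (E : IntermediateField ℚ_[p] (PadicAlgCl p)) (hE : FiniteDimensional ℚ_[p] E)
        (rE : FramedGaloisRep (v.adicCompletion K) E n),
        Literature.NumberTheory.Automorphic.HasQlModel (ρ.toLocal v) E rE ∧
          IsTrianguline (𝔇 E hE) ((Φ E hE).app n rE) :=
  Iff.rfl

/-- **`δ` is a parameter of `ρ` at `v` for the reindexed family iff some model `rE` of `ρ|Γ_{K_v}`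
over a finite `E` has `Φ_E rE` trianguline for `𝔇_E` with an `E`-descent of `δ` as parameter.**
[folklore] -/
theorem hasParameterAt_reindex_iff (v : HeightOneSpectrum (𝓞 K))
    (𝔇 : ∀ E : IntermediateField ℚ_[p] (PadicAlgCl p), FiniteDimensional ℚ_[p] E →
      PhiGammaModuleData.{0, 0, 0} p (v.adicCompletion K) E)
    (Φ : ∀ E : IntermediateField ℚ_[p] (PadicAlgCl p), FiniteDimensional ℚ_[p] E →
      FramedRep.ReindexingFamily (absoluteGaloisGroup (v.adicCompletion K)) E)
    (ρ : FramedGaloisRep K (PadicAlgCl p) n)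
    (δ : Fin n → ((v.adicCompletion K)ˣ →ₜ* (PadicAlgCl p)ˣ)) :
    ρ.HasParameterAt v (fun E hE => (𝔇 E hE).reindex (Φ E hE)) δ ↔
      ∃ (E : IntermediateField ℚ_[p] (PadicAlgCl p)) (hE : FiniteDimensional ℚ_[p] E)
        (rE : FramedGaloisRep (v.adicCompletion K) E n)
        (δE : Fin n → ((v.adicCompletion K)ˣ →ₜ* Eˣ)),
        Literature.NumberTheory.Automorphic.HasQlModel (ρ.toLocal v) E rE ∧
          IsTriangulineWith (𝔇 E hE) ((Φ E hE).app n rE) δE ∧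
            ∀ (i : Fin n) (x : (v.adicCompletion K)ˣ),
              ((δ i x : (PadicAlgCl p)ˣ) : PadicAlgCl p) = algebraMap E (PadicAlgCl p) (δE i x : Eˣ) :=
  Iff.rfl

/-- **A parameter prescribed in every KPX theory is a parameter of every reindexed model.**  If
`ρ` has the parameter `δ` at `v` relative to `𝔇.toPhiGammaModuleData` for EVERY family `𝔇` of
enriched data satisfying the KPX package `IsKPX d`, then for every such family `𝔇` and every family
`Φ` of reindexings fixing `1`, some model `rE` of `ρ|Γ_{K_v}` over a finite `E` has `Φ_E rE`
trianguline for `𝔇_E` with an `E`-descent of the SAME `δ` (apply the hypothesis to the reindexed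
family, which is again KPX by `IsKPX.reindex`).  With `Φ = twistSwap μ` or `dual` this is the
content a faithful `D_rig^†` would refute for `ρ|Γ_{K_v}` of rank `≥ 2` with a unique
triangulation. [folklore] -/
theorem hasParameterAt_reindexed_of_forall_isKPX (v : HeightOneSpectrum (𝓞 K)) (d : ℕ)
    (ρ : FramedGaloisRep K (PadicAlgCl p) n)
    (δ : Fin n → ((v.adicCompletion K)ˣ →ₜ* (PadicAlgCl p)ˣ))
    (hρ : ∀ 𝔇 : (∀ E : IntermediateField ℚ_[p] (PadicAlgCl p), FiniteDimensional ℚ_[p] E →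
        PhiGammaModuleRobba.{0, 0, 0} p (v.adicCompletion K) E),
      (∀ (E : IntermediateField ℚ_[p] (PadicAlgCl p)) (hE : FiniteDimensional ℚ_[p] E), (𝔇 E hE).IsKPX d) →
        ρ.HasParameterAt v (fun E hE => (𝔇 E hE).toPhiGammaModuleData) δ)
    (𝔇 : ∀ E : IntermediateField ℚ_[p] (PadicAlgCl p), FiniteDimensional ℚ_[p] E →
      PhiGammaModuleRobba.{0, 0, 0} p (v.adicCompletion K) E)
    (h𝔇 : ∀ (E : IntermediateField ℚ_[p] (PadicAlgCl p)) (hE : FiniteDimensional ℚ_[p] E), (𝔇 E hE).IsKPX d)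
    (Φ : ∀ E : IntermediateField ℚ_[p] (PadicAlgCl p), FiniteDimensional ℚ_[p] E →
      FramedRep.ReindexingFamily (absoluteGaloisGroup (v.adicCompletion K)) E) :
    ∃ (E : IntermediateField ℚ_[p] (PadicAlgCl p)) (hE : FiniteDimensional ℚ_[p] E)
      (rE : FramedGaloisRep (v.adicCompletion K) E n)
      (δE : Fin n → ((v.adicCompletion K)ˣ →ₜ* Eˣ)),
      Literature.NumberTheory.Automorphic.HasQlModel (ρ.toLocal v) E rE ∧
        IsTriangulineWith (𝔇 E hE).toPhiGammaModuleData ((Φ E hE).app n rE) δE ∧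
          ∀ (i : Fin n) (x : (v.adicCompletion K)ˣ),
            ((δ i x : (PadicAlgCl p)ˣ) : PadicAlgCl p) = algebraMap E (PadicAlgCl p) (δE i x : Eˣ) :=
  (hasParameterAt_reindex_iff v (fun E hE => (𝔇 E hE).toPhiGammaModuleData) Φ ρ δ).1
    (hρ (fun E hE => (𝔇 E hE).reindex (Φ E hE)) fun E hE => (h𝔇 E hE).reindex (Φ E hE))

end FramedGaloisRep

end Literature.NumberTheory.GaloisRepresentations

end
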